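import Literature.NumberTheory.Irrationality.LaiYu2020.AnalysisLemmaProfile
import Literature.NumberTheory.Irrationality.LaiYu2020.ZeroSetCardinality
import HarnessLib

/-!
# Lai–Yu 2020, Proposition 4.2 (2) (upper half): `log g(x₀) ≤ −(1+κ)(s+1)` for `B = c√s/√(log s)`

Topic `Literature/NumberTheory/Irrationality/LaiYu2020`, namespace
`Literature.NumberTheory.Irrationality.LaiYu2020` (helpers in `Lemma41`). Source: L. Lai, P. Yu, *A note on the
number of irrational odd zeta values*, Compositio Math. 156 (2020) 1699–1717, arXiv:1911.08458, §4, Proposition 4.2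
(2) and its proof (p. 9 of the arXiv version) [LaiYu2020].

Printed statement (Prop. 4.2 (2)): "Let `r > 0` be a fixed rational number and `B = c√s/√(log s)` for a constant
`c > 0`; then as `s → +∞` we have `x₀ → 0` and `g(x₀) = exp(((A/4)(2r+1)c² + r log r − (r+1) log(r+1) + o(1)) s)`,
`A = ζ(2)ζ(3)/ζ(6)`."  What §5 USES of it is the upper half: `g(x₀) < exp(−(s+1))` (indeed with a margin) as soon
as `(A/4)(2r+1)c² + r log r − (r+1) log(r+1) < −1`, i.e. `(2r+1) A c²/4 < φ̃(r) := (r+1) log(r+1) − r log r − 1`.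
This file PROVES that upper half, in the form consumed by the elimination step and the proof of Theorem 1.1
(`eventually_Lam_le`): there is `κ > 0` with `Λ(x₀) = log g(x₀) ≤ −(1+κ)(s+1)` for all large `s` and every
`0 ≤ x₀ ≤ r(r+1)` (the root of `f = 1` lies in `(0, r(r+1)N/a) ⊆ (0, r(r+1)]` once `a = s+1−(2r+1)N ≥ N`,
`AnalysisLemmaProfile.exists_root`).

Architecture (following the printed proof, p. 9: "log A₁(B) ∼ (A/2)(2r+1)B² log B ∼ (A/4)(2r+1)c² s,
log A₂(B) ≪ B² (log log B)² = o(s), |𝓕_B| log |Ψ_B| ≪ B² log B... " — here with the tree's cruder but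
sufficient `|𝓕_B| ≤ B²` (`card_zeroSet_le_sq`), which already makes every `|𝓕_B|`-term `o(s)` because the
`x₀`-dependence is bounded UNIFORMLY on `[0, r(r+1)]`, so that `x₀ → 0` is not needed):
* `Lam_le_of_le` — the pointwise bound `Λ(x₀) ≤ log A₁ + log A₂ − (s+1) + (2r+1)N(1+log v) + (2r+1)N log(R+2r+1)
  − (s+1) φ̃(r)` for `0 ≤ x₀ ≤ R` (`F(x+ρ) − F(x) ≤ ρ log(x+ρ)`; `x ↦ F(x+r+1) − F(x+r)` is increasing, MVT);
* `Bfun c s = c√s/√(log s)`: `Bfun → ∞`, `B² log B/(s+1) → c²/2`, `B²/(s+1) → 0`, `B²(log log B)²/(s+1) → 0`;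
* `tendsto_log_A₁_Bfun_div` — `log A₁(B_s)/(s+1) → (2r+1) A c²/4` (tree `tendsto_log_A₁_div`, Lemma 2.4);
  `eventually_log_A₂_Bfun_le` — `log A₂(B_s) ≤ η(s+1)` (tree `A₂_le`); `eventually_card_zeroSet_Bfun_le` —
  `|𝓕_{B_s}| ≤ η(s+1)`;
* `eventually_Lam_le` — the conclusion.
WHAT THIS IS NOT: the lower half / the exact asymptotics of `g(x₀)` and `x₀ → 0` are not formalized (not used
in the proof of Theorem 1.1). Cell zeta5-irr (rung F-Z1): nothing here bears on `ζ(5)`.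
-/

open Finset Filter
open scoped Topology

namespace Literature.NumberTheory.Irrationality.LaiYu2020

open Literature.NumberTheory.Irrationality.FischlerSprangZudilin2019.Lemma3 (F F_sub_F_le le_F_sub_F hasDerivAt_F)
open Literature.NumberTheory.Multiplicative.TotientValueCounting (density density_pos)

namespace Lemma41

/-! ### The function `φ̃(r) = (r+1) log(r+1) − r log r − 1 = F(r+1) − F(r)` -/

/-- `φ̃(r) = (r+1) log(r+1) − r log r − 1` (so that the printed exponent of Prop. 4.2 (2) is
`(A/4)(2r+1)c² − φ̃(r) − 1`). [cite: LaiYu2020, Prop. 4.2 (2)] -/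
noncomputable def phitilde (r : ℝ) : ℝ := (r + 1) * Real.log (r + 1) - r * Real.log r - 1

/-- `F(r+1) − F(r) = φ̃(r)`. [cite: LaiYu2020, Prop. 4.2 (2) (proof, "g(x₀) = … r log r − (r+1) log(r+1)")] -/
theorem F_succ_sub_F (r : ℝ) : F (r + 1) - F r = phitilde r := by
  unfold F phitilde
  ring

/-- `x ↦ F(x+r+1) − F(x+r)` is increasing on `[0, ∞)` (`r > 0`): `F(r+1) − F(r) ≤ F(x+r+1) − F(x+r)` for
`x ≥ 0` (mean value theorem; the derivative is `log(y+1) − log y > 0`).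
[cite: LaiYu2020, Prop. 4.2 (2) (proof: the `(s+1)`-part of `log g(x₀)` at `x₀ → 0`)] -/
theorem F_shift_mono {r x : ℝ} (hr : 0 < r) (hx : 0 ≤ x) :
    F (r + 1) - F r ≤ F (x + r + 1) - F (x + r) := by
  rcases hx.eq_or_lt with h | h
  · rw [← h, zero_add]
  · -- MVT for `G(y) = F(y+1) − F(y)` on `[r, x+r]`
    have hG : ∀ y, 0 < y → HasDerivAt (fun y => F (y + 1) - F y) (Real.log (y + 1) - Real.log y) y := by
      intro y hy
      have h1 : HasDerivAt (fun y => F (y + 1)) (Real.log (y + 1)) y := by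
        have := (hasDerivAt_F (t := y + 1) (by linarith)).comp y ((hasDerivAt_id y).add_const 1)
        simpa [Function.comp_def] using this
      exact h1.sub (hasDerivAt_F hy.ne')
    have hcont : ContinuousOn (fun y => F (y + 1) - F y) (Set.Icc r (x + r)) :=
      fun y hy => (hG y (lt_of_lt_of_le hr hy.1)).continuousAt.continuousWithinAt
    have hdiff : ∀ y ∈ Set.Ioo r (x + r), HasDerivAt (fun y => F (y + 1) - F y) (Real.log (y + 1) - Real.log y) y :=
      fun y hy => hG y (hr.trans hy.1)
    obtain ⟨ξ, hξ, hslope⟩ := exists_hasDerivAt_eq_slope (fun y => F (y + 1) - F y)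
      (fun y => Real.log (y + 1) - Real.log y) (by linarith) hcont hdiff
    have hξ0 : 0 < ξ := hr.trans hξ.1
    have hpos : 0 ≤ Real.log (ξ + 1) - Real.log ξ := by
      rw [sub_nonneg]
      exact Real.log_le_log hξ0 (by linarith)
    rw [hslope] at hpos
    have hxr : 0 < x + r - r := by linarith
    have := (div_nonneg_iff.1 hpos)
    rcases this with ⟨hnum, -⟩ | ⟨-, hden⟩
    · have e : x + r + 1 = (x + r) + 1 := by ring
      rw [e]
      linarith
    · linarith

/-! ### The pointwise bound for `Λ` on `[0, R]` -/

/-- **Pointwise upper bound for the profile**: for `0 ≤ x₀ ≤ R`,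
`Λ(x₀) ≤ log A₁(B) + log A₂(B) − (s+1) + (2r+1)N(1 + log v) + (2r+1)N log(R+2r+1) − (s+1)φ̃(r)`
(`N = |𝓕_B|`, `r = u/v`). [cite: LaiYu2020, Prop. 4.2 (2) (proof: "g(x₀) = A₁A₂ exp(o(s)) (r^r/(r+1)^{r+1})^{s+1} e^{-(s+1)}")] -/
theorem Lam_le_of_le {u v : ℕ} (hu : 1 ≤ u) (hv : 1 ≤ v) (s : ℕ) (B : ℝ) {x₀ R : ℝ} (hx₀ : 0 ≤ x₀)
    (hxR : x₀ ≤ R) :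
    Lam u v s B x₀ ≤ Real.log (A₁ ((u : ℚ) / v) B) + Real.log (A₂ ((u : ℚ) / v) B) - ((s : ℝ) + 1) +
      (2 * (u : ℝ) + v) / v * ((zeroSet_finite B).toFinset.card : ℝ) * (1 + Real.log v) +
      ((zeroSet_finite B).toFinset.card : ℝ) * ((2 * (u : ℝ) + v) / v * Real.log (R + (2 * (u : ℝ) + v) / v)) -
      ((s : ℝ) + 1) * phitilde ((u : ℝ) / v) := by
  have hv0 : (0 : ℝ) < v := by exact_mod_cast hv
  have hu0 : (0 : ℝ) < u := by exact_mod_cast hu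
  have hρ : 0 < (2 * (u : ℝ) + v) / v := by positivity
  have hr : 0 < (u : ℝ) / v := by positivity
  have hN : (0 : ℝ) ≤ ((zeroSet_finite B).toFinset.card : ℝ) := Nat.cast_nonneg _
  -- the `N`-term
  have h1 : F (x₀ + (2 * (u : ℝ) + v) / v) - F x₀ ≤ (2 * (u : ℝ) + v) / v * Real.log (R + (2 * (u : ℝ) + v) / v) := by
    have h := F_sub_F_le hx₀ (show x₀ ≤ x₀ + (2 * (u : ℝ) + v) / v by linarith)
    have hlog : Real.log (x₀ + (2 * (u : ℝ) + v) / v) ≤ Real.log (R + (2 * (u : ℝ) + v) / v) :=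
      Real.log_le_log (by linarith) (by linarith)
    calc _ ≤ (x₀ + (2 * (u : ℝ) + v) / v - x₀) * Real.log (x₀ + (2 * (u : ℝ) + v) / v) := h
      _ = (2 * (u : ℝ) + v) / v * Real.log (x₀ + (2 * (u : ℝ) + v) / v) := by ring
      _ ≤ _ := mul_le_mul_of_nonneg_left hlog hρ.le
  -- the `(s+1)`-term
  have h2 : phitilde ((u : ℝ) / v) ≤ F (x₀ + (u : ℝ) / v + 1) - F (x₀ + (u : ℝ) / v) := by
    rw [← F_succ_sub_F]
    exact F_shift_mono hr hx₀
  have h1' := mul_le_mul_of_nonneg_left h1 hN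
  have h2' := mul_le_mul_of_nonneg_left h2 (show (0 : ℝ) ≤ (s : ℝ) + 1 by positivity)
  unfold Lam
  linarith

/-! ### The parameter `B = c√s/√(log s)` -/

/-- `B(s) = c √s / √(log s)`. [cite: LaiYu2020, Prop. 4.2 (2) ("B = c√s/√log s")] -/
noncomputable def Bfun (c : ℝ) (s : ℕ) : ℝ := c * Real.sqrt s / Real.sqrt (Real.log s)

/-- `B(s)² = c² s / log s` (`s ≥ 2`). [cite: LaiYu2020, Prop. 4.2 (2)] -/
theorem Bfun_sq (c : ℝ) {s : ℕ} (hs : 2 ≤ s) : Bfun c s ^ 2 = c ^ 2 * s / Real.log s := by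
  have hs0 : (0 : ℝ) ≤ s := Nat.cast_nonneg s
  have hlog : 0 ≤ Real.log s := Real.log_nonneg (by exact_mod_cast (show 1 ≤ s by omega))
  unfold Bfun
  rw [div_pow, mul_pow, Real.sq_sqrt hs0, Real.sq_sqrt hlog]

/-- `B(s) > 0` (`c > 0`, `s ≥ 2`). [cite: LaiYu2020, Prop. 4.2 (2)] -/
theorem Bfun_pos {c : ℝ} (hc : 0 < c) {s : ℕ} (hs : 2 ≤ s) : 0 < Bfun c s := by
  have hs1 : (1 : ℝ) < s := by exact_mod_cast (show 1 < s by omega)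
  unfold Bfun
  exact div_pos (mul_pos hc (Real.sqrt_pos.2 (by linarith))) (Real.sqrt_pos.2 (Real.log_pos hs1))

/-- `log B(s) = log c + ½ log s − ½ log log s` (`c > 0`, `s ≥ 2`). [cite: LaiYu2020, Prop. 4.2 (2)] -/
theorem log_Bfun {c : ℝ} (hc : 0 < c) {s : ℕ} (hs : 2 ≤ s) :
    Real.log (Bfun c s) = Real.log c + Real.log s / 2 - Real.log (Real.log s) / 2 := by
  have hs1 : (1 : ℝ) < s := by exact_mod_cast (show 1 < s by omega)
  have hlog : 0 < Real.log s := Real.log_pos hs1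
  unfold Bfun
  rw [Real.log_div (mul_pos hc (Real.sqrt_pos.2 (by linarith))).ne' (Real.sqrt_pos.2 hlog).ne',
    Real.log_mul hc.ne' (Real.sqrt_pos.2 (by linarith)).ne', Real.log_sqrt (by linarith),
    Real.log_sqrt hlog.le]

/-- `s / log s → ∞`. [cite: LaiYu2020, Prop. 4.2 (2)] -/
theorem tendsto_div_log_atTop : Tendsto (fun s : ℕ => (s : ℝ) / Real.log s) atTop atTop := by
  have h1 : Tendsto (fun x : ℝ => Real.log x / x) atTop (𝓝 0) :=
    Real.isLittleO_log_id_atTop.tendsto_div_nhds_zero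
  have h2 : Tendsto (fun x : ℝ => Real.log x / x) atTop (𝓝[>] 0) := by
    refine tendsto_nhdsWithin_iff.2 ⟨h1, ?_⟩
    filter_upwards [eventually_gt_atTop 1] with x hx
    exact div_pos (Real.log_pos hx) (by linarith)
  have h3 : Tendsto (fun x : ℝ => (Real.log x / x)⁻¹) atTop atTop := tendsto_inv_nhdsGT_zero.comp h2
  refine (h3.comp tendsto_natCast_atTop_atTop).congr fun s => ?_
  simp [inv_div]

/-- `B(s) → ∞` (`c > 0`). [cite: LaiYu2020, Prop. 4.2 (2)] -/
theorem tendsto_Bfun_atTop {c : ℝ} (hc : 0 < c) : Tendsto (fun s : ℕ => Bfun c s) atTop atTop := by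
  have h1 : Tendsto (fun s : ℕ => Real.sqrt ((s : ℝ) / Real.log s)) atTop atTop :=
    Real.tendsto_sqrt_atTop.comp tendsto_div_log_atTop
  have h2 : Tendsto (fun s : ℕ => c * Real.sqrt ((s : ℝ) / Real.log s)) atTop atTop :=
    h1.const_mul_atTop hc
  refine h2.congr' ?_
  filter_upwards [eventually_ge_atTop 2] with s hs
  unfold Bfun
  rw [Real.sqrt_div' _ (Real.log_nonneg (by exact_mod_cast (show 1 ≤ s by omega))), mul_div_assoc]

/-- `log(log s)/log s → 0`. [cite: LaiYu2020, Prop. 4.2 (2)] -/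
theorem tendsto_loglog_div_log : Tendsto (fun s : ℕ => Real.log (Real.log (s : ℝ)) / Real.log s) atTop (𝓝 0) :=
  (Real.isLittleO_log_id_atTop.tendsto_div_nhds_zero.comp
    (Real.tendsto_log_atTop.comp tendsto_natCast_atTop_atTop))

/-- `(log log s)²/log s → 0`. [cite: LaiYu2020, Prop. 4.2 (2)] -/
theorem tendsto_loglog_sq_div_log :
    Tendsto (fun s : ℕ => Real.log (Real.log (s : ℝ)) ^ 2 / Real.log s) atTop (𝓝 0) := by
  have h := (Real.tendsto_pow_log_div_mul_add_atTop 1 0 2 one_ne_zero).comp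
    (Real.tendsto_log_atTop.comp tendsto_natCast_atTop_atTop)
  refine h.congr fun s => ?_
  simp

/-- `s/(s+1) → 1`. [cite: LaiYu2020, Prop. 4.2 (2)] -/
theorem tendsto_div_succ : Tendsto (fun s : ℕ => (s : ℝ) / ((s : ℝ) + 1)) atTop (𝓝 1) := by
  have h : Tendsto (fun s : ℕ => 1 - 1 / ((s : ℝ) + 1)) atTop (𝓝 (1 - 0)) :=
    tendsto_const_nhds.sub (tendsto_one_div_add_atTop_nhds_zero_nat)
  rw [sub_zero] at h
  refine h.congr fun s => ?_
  have : (s : ℝ) + 1 ≠ 0 := by positivity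
  field_simp
  ring

/-- **`B(s)² log B(s)/(s+1) → c²/2`**. [cite: LaiYu2020, Prop. 4.2 (2) (proof, "B² log B ∼ c² s/2")] -/
theorem tendsto_Bsq_log_div {c : ℝ} (hc : 0 < c) :
    Tendsto (fun s : ℕ => Bfun c s ^ 2 * Real.log (Bfun c s) / ((s : ℝ) + 1)) atTop (𝓝 (c ^ 2 / 2)) := by
  -- `= c² · (s/(s+1)) · (log c/log s + 1/2 − (log log s/log s)/2)`
  have hL : Tendsto (fun s : ℕ => Real.log (s : ℝ)) atTop atTop :=
    Real.tendsto_log_atTop.comp tendsto_natCast_atTop_atTop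
  have h1 : Tendsto (fun s : ℕ => Real.log c / Real.log (s : ℝ)) atTop (𝓝 0) :=
    hL.const_div_atTop _
  have h2 := tendsto_loglog_div_log
  have h3 : Tendsto (fun s : ℕ => Real.log c / Real.log (s : ℝ) + 1 / 2 - Real.log (Real.log (s : ℝ)) / Real.log s / 2)
      atTop (𝓝 (0 + 1 / 2 - 0 / 2)) := (h1.add tendsto_const_nhds).sub (h2.div_const 2)
  have h4 := (tendsto_div_succ.const_mul (c ^ 2)).mul h3
  have e : c ^ 2 * 1 * (0 + 1 / 2 - 0 / 2) = c ^ 2 / 2 := by ring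
  rw [e] at h4
  refine h4.congr' ?_
  filter_upwards [eventually_ge_atTop 2] with s hs
  have hs1 : (1 : ℝ) < s := by exact_mod_cast (show 1 < s by omega)
  have hlog : 0 < Real.log s := Real.log_pos hs1
  have hs1' : (0 : ℝ) < (s : ℝ) + 1 := by positivity
  rw [Bfun_sq c hs, log_Bfun hc hs]
  field_simp

/-- **`B(s)²/(s+1) → 0`**. [cite: LaiYu2020, Prop. 4.2 (2) (proof, "|𝓕_B| ≤ … = o(s)")] -/
theorem tendsto_Bsq_div {c : ℝ} (hc : 0 < c) :
    Tendsto (fun s : ℕ => Bfun c s ^ 2 / ((s : ℝ) + 1)) atTop (𝓝 0) := by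
  have hL : Tendsto (fun s : ℕ => Real.log (s : ℝ)) atTop atTop :=
    Real.tendsto_log_atTop.comp tendsto_natCast_atTop_atTop
  have h1 : Tendsto (fun s : ℕ => c ^ 2 / Real.log (s : ℝ)) atTop (𝓝 0) := hL.const_div_atTop _
  have h2 := tendsto_div_succ.mul h1
  rw [mul_zero] at h2
  refine h2.congr' ?_
  filter_upwards [eventually_ge_atTop 2] with s hs
  have hs1 : (1 : ℝ) < s := by exact_mod_cast (show 1 < s by omega)
  have hlog : 0 < Real.log s := Real.log_pos hs1
  have hc0 : c ≠ 0 := hc.ne'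
  rw [Bfun_sq c hs]
  field_simp

/-- **`B(s)² (log log B(s))²/(s+1) → 0`**. [cite: LaiYu2020, Prop. 4.2 (2) (proof, "log A₂(B) ≪ B²(log log B)² = o(s)")] -/
theorem tendsto_Bsq_loglog_sq_div {c : ℝ} (hc : 0 < c) :
    Tendsto (fun s : ℕ => Bfun c s ^ 2 * Real.log (Real.log (Bfun c s)) ^ 2 / ((s : ℝ) + 1)) atTop (𝓝 0) := by
  -- squeeze between `0` and `c² (s/(s+1)) (log log s)²/log s`
  have hup : Tendsto (fun s : ℕ => c ^ 2 * ((s : ℝ) / ((s : ℝ) + 1)) * (Real.log (Real.log (s : ℝ)) ^ 2 / Real.log s))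
      atTop (𝓝 0) := by
    have := (tendsto_div_succ.const_mul (c ^ 2)).mul tendsto_loglog_sq_div_log
    simpa using this
  have hB := tendsto_Bfun_atTop hc
  have hBe : ∀ᶠ s : ℕ in atTop, Real.exp (Real.exp 0) ≤ Bfun c s := hB.eventually_ge_atTop _
  -- `B(s) ≤ s` eventually (`c √s/√log s ≤ c √s ≤ s` for `s ≥ c²` and `log s ≥ 1`)
  have hBs : ∀ᶠ s : ℕ in atTop, Bfun c s ≤ s := by
    filter_upwards [eventually_ge_atTop 3, eventually_ge_atTop ⌈c ^ 2⌉₊] with s hs3 hsc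
    have hs0 : (0 : ℝ) < s := by exact_mod_cast (show 0 < s by omega)
    have hs3' : (3 : ℝ) ≤ s := by exact_mod_cast hs3
    have hc2 : c ^ 2 ≤ s := (Nat.le_ceil _).trans (by exact_mod_cast hsc)
    have hlog1 : 1 ≤ Real.log s := by
      rw [← Real.log_exp 1]
      exact Real.log_le_log (Real.exp_pos 1) (by linarith [Real.exp_one_lt_d9])
    have hsq1 : 1 ≤ Real.sqrt (Real.log s) := by
      rw [← Real.sqrt_one]; exact Real.sqrt_le_sqrt hlog1
    unfold Bfun
    rw [div_le_iff₀ (by linarith)]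
    have hcs : c * Real.sqrt s ≤ s := by
      have h1 : c ≤ Real.sqrt s := by
        rw [← Real.sqrt_sq hc.le]; exact Real.sqrt_le_sqrt hc2
      calc c * Real.sqrt s ≤ Real.sqrt s * Real.sqrt s := mul_le_mul_of_nonneg_right h1 (Real.sqrt_nonneg _)
        _ = s := Real.mul_self_sqrt hs0.le
    nlinarith [Real.sqrt_nonneg (s : ℝ)]
  refine tendsto_of_tendsto_of_tendsto_of_le_of_le' tendsto_const_nhds hup ?_ ?_
  · filter_upwards with s
    positivity
  · filter_upwards [hBe, hBs, eventually_ge_atTop 3] with s hBe' hBs' hs3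
    have hs1 : (1 : ℝ) < s := by exact_mod_cast (show 1 < s by omega)
    have hlog : 0 < Real.log s := Real.log_pos hs1
    have hB0 : 0 < Bfun c s := lt_of_lt_of_le (Real.exp_pos _) hBe'
    -- `1 ≤ log B ≤ log s`, so `0 ≤ log log B ≤ log log s`
    have hlB1 : 1 ≤ Real.log (Bfun c s) := by
      have := Real.log_le_log (Real.exp_pos _) hBe'
      rwa [Real.log_exp, Real.exp_zero] at this
    have hlBs : Real.log (Bfun c s) ≤ Real.log s := Real.log_le_log hB0 hBs'
    have hll0 : 0 ≤ Real.log (Real.log (Bfun c s)) := Real.log_nonneg hlB1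
    have hll : Real.log (Real.log (Bfun c s)) ≤ Real.log (Real.log s) := Real.log_le_log (by linarith) hlBs
    have hsq : Real.log (Real.log (Bfun c s)) ^ 2 ≤ Real.log (Real.log (s : ℝ)) ^ 2 :=
      pow_le_pow_left₀ hll0 hll 2
    have hs1' : (0 : ℝ) < (s : ℝ) + 1 := by positivity
    rw [Bfun_sq c (by omega)]
    have e : c ^ 2 * ((s : ℝ) / ((s : ℝ) + 1)) * (Real.log (Real.log (s : ℝ)) ^ 2 / Real.log s) =
        c ^ 2 * s / Real.log s * Real.log (Real.log (s : ℝ)) ^ 2 / ((s : ℝ) + 1) := by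
      field_simp
    rw [e]
    have h0 : 0 ≤ c ^ 2 * s / Real.log s := by positivity
    exact div_le_div_of_nonneg_right (mul_le_mul_of_nonneg_left hsq h0) hs1'.le

/-! ### The three `o(s)` / `O(s)` inputs along `B = B(s)` -/

/-- **`log A₁(B(s))/(s+1) → (2r+1) A c²/4`** (`A = density = ζ(2)ζ(3)/ζ(6)`; Lemma 2.4 for `A₁` composed with
`B² log B ∼ c² s/2`). [cite: LaiYu2020, Prop. 4.2 (2) (proof, "log A₁(B) = ((A/4)(2r+1)c² + o(1)) s")] -/
theorem tendsto_log_A₁_Bfun_div {u v : ℕ} (hu : 1 ≤ u) (hv : 1 ≤ v) {c : ℝ} (hc : 0 < c) :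
    Tendsto (fun s : ℕ => Real.log (A₁ ((u : ℚ) / v) (Bfun c s)) / ((s : ℝ) + 1)) atTop
      (𝓝 ((2 * (u : ℝ) + v) / v * density * c ^ 2 / 4)) := by
  have hv0 : (0 : ℝ) < v := by exact_mod_cast hv
  have hu0 : (0 : ℝ) < u := by exact_mod_cast hu
  have hr : (0 : ℚ) < (u : ℚ) / v := by
    have : (0 : ℚ) < u := by exact_mod_cast hu
    have : (0 : ℚ) < v := by exact_mod_cast hv
    positivity
  have hρ : (2 * (((u : ℚ) / v : ℚ) : ℝ) + 1) = (2 * (u : ℝ) + v) / v := by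
    push_cast
    field_simp
  have h1 := (tendsto_log_A₁_div hr).comp (tendsto_Bfun_atTop hc)
  have h2 : Tendsto (fun s : ℕ => (2 * (u : ℝ) + v) / v * (Bfun c s ^ 2 * Real.log (Bfun c s) / ((s : ℝ) + 1)))
      atTop (𝓝 ((2 * (u : ℝ) + v) / v * (c ^ 2 / 2))) := (tendsto_Bsq_log_div hc).const_mul _
  have h3 := h1.mul h2
  have e : density / 2 * ((2 * (u : ℝ) + v) / v * (c ^ 2 / 2)) = (2 * (u : ℝ) + v) / v * density * c ^ 2 / 4 := by
    ring
  rw [e] at h3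
  refine h3.congr' ?_
  have hB1 : ∀ᶠ s : ℕ in atTop, 2 ≤ Bfun c s := (tendsto_Bfun_atTop hc).eventually_ge_atTop _
  filter_upwards [hB1] with s hs
  have hB0 : 0 < Bfun c s := by linarith
  have hlogB : 0 < Real.log (Bfun c s) := Real.log_pos (by linarith)
  have hs1 : (0 : ℝ) < (s : ℝ) + 1 := by positivity
  have hρ0 : (2 * (u : ℝ) + v) / v ≠ 0 := by positivity
  simp only [Function.comp, hρ]
  field_simp

/-- **`log A₂(B(s)) ≤ η (s+1)` for all large `s`** (every `η > 0`; Lemma 2.4 for `A₂` and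
`B²(log log B)² = o(s)`). [cite: LaiYu2020, Prop. 4.2 (2) (proof, "log A₂(B) = o(s)")] -/
theorem eventually_log_A₂_Bfun_le {u v : ℕ} (hu : 1 ≤ u) (hv : 1 ≤ v) {c : ℝ} (hc : 0 < c) {η : ℝ}
    (hη : 0 < η) :
    ∀ᶠ s : ℕ in atTop, Real.log (A₂ ((u : ℚ) / v) (Bfun c s)) ≤ η * ((s : ℝ) + 1) := by
  have hv0 : (0 : ℝ) < v := by exact_mod_cast hv
  have hu0 : (0 : ℝ) < u := by exact_mod_cast hu
  have hr : (0 : ℚ) < (u : ℚ) / v := by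
    have : (0 : ℚ) < u := by exact_mod_cast hu
    have : (0 : ℚ) < v := by exact_mod_cast hv
    positivity
  have hρ : (2 * (((u : ℚ) / v : ℚ) : ℝ) + 1) = (2 * (u : ℝ) + v) / v := by
    push_cast
    field_simp
  have hρ0 : 0 < (2 * (u : ℝ) + v) / v := by positivity
  obtain ⟨B₀, hB₀⟩ := A₂_le hr
  have hB : ∀ᶠ s : ℕ in atTop, B₀ ≤ Bfun c s := (tendsto_Bfun_atTop hc).eventually_ge_atTop _
  have hsmall : ∀ᶠ s : ℕ in atTop, Bfun c s ^ 2 * Real.log (Real.log (Bfun c s)) ^ 2 / ((s : ℝ) + 1) <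
      η / (10 * ((2 * (u : ℝ) + v) / v)) :=
    (tendsto_Bsq_loglog_sq_div hc).eventually_lt_const (by positivity)
  filter_upwards [hB, hsmall] with s hs hlt
  have hs1 : (0 : ℝ) < (s : ℝ) + 1 := by positivity
  have h1 : Real.log (A₂ ((u : ℚ) / v) (Bfun c s)) ≤
      10 * ((2 * (u : ℝ) + v) / v) * Bfun c s ^ 2 * Real.log (Real.log (Bfun c s)) ^ 2 := by
    have := Real.log_le_log (A₂_pos _ _) (hB₀ _ hs)
    rwa [Real.log_exp, hρ] at this
  rw [div_lt_iff₀ hs1] at hlt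
  have h2 : 10 * ((2 * (u : ℝ) + v) / v) * (Bfun c s ^ 2 * Real.log (Real.log (Bfun c s)) ^ 2) ≤
      10 * ((2 * (u : ℝ) + v) / v) * (η / (10 * ((2 * (u : ℝ) + v) / v)) * ((s : ℝ) + 1)) :=
    mul_le_mul_of_nonneg_left hlt.le (by positivity)
  have e : 10 * ((2 * (u : ℝ) + v) / v) * (η / (10 * ((2 * (u : ℝ) + v) / v)) * ((s : ℝ) + 1)) = η * ((s : ℝ) + 1) := by
    field_simp
  linarith

/-- **`|𝓕_{B(s)}| ≤ η (s+1)` for all large `s`** (every `η > 0`; `|𝓕_B| ≤ B² = O(s/log s)`).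
[cite: LaiYu2020, Prop. 4.2 (2) (proof, "|𝓕_B| ≤ (A+o(1))B² = o(s)")] -/
theorem eventually_card_zeroSet_Bfun_le {c : ℝ} (hc : 0 < c) {η : ℝ} (hη : 0 < η) :
    ∀ᶠ s : ℕ in atTop, ((zeroSet_finite (Bfun c s)).toFinset.card : ℝ) ≤ η * ((s : ℝ) + 1) := by
  obtain ⟨B₀, hB₀⟩ := card_zeroSet_le_sq
  have hB : ∀ᶠ s : ℕ in atTop, B₀ ≤ Bfun c s := (tendsto_Bfun_atTop hc).eventually_ge_atTop _
  have hsmall : ∀ᶠ s : ℕ in atTop, Bfun c s ^ 2 / ((s : ℝ) + 1) < η :=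
    (tendsto_Bsq_div hc).eventually_lt_const hη
  filter_upwards [hB, hsmall] with s hs hlt
  have hs1 : (0 : ℝ) < (s : ℝ) + 1 := by positivity
  have h1 : ((zeroSet_finite (Bfun c s)).toFinset.card : ℝ) ≤ Bfun c s ^ 2 := by
    rw [← Set.ncard_eq_toFinset_card _ (zeroSet_finite (Bfun c s))]
    exact hB₀ _ hs
  rw [div_lt_iff₀ hs1] at hlt
  linarith

/-! ### Proposition 4.2 (2), upper half -/

/-- **Lai–Yu 2020, Proposition 4.2 (2), upper half (PROVED)**: let `r = u/v > 0` and `c > 0` with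
`(2r+1) A c²/4 < φ̃(r) = (r+1) log(r+1) − r log r − 1` (i.e. the printed exponent
`(A/4)(2r+1)c² + r log r − (r+1) log(r+1)` is `< −1`). Then there is `κ > 0` such that for all large `s`, with
`B = c√s/√(log s)`, `Λ(x₀) = log g(x₀) ≤ −(1+κ)(s+1)` for every `0 ≤ x₀ ≤ r(r+1)` — in particular at the root
`x₀` of `f = 1` (which lies below `r(r+1)N/a ≤ r(r+1)` once `a ≥ N`). This is the form of
"`g(x₀) = exp(((A/4)(2r+1)c² + r log r − (r+1) log(r+1) + o(1)) s) < exp(−(s+1))`" used in §5.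
[cite: LaiYu2020, Prop. 4.2 (2)] -/
theorem eventually_Lam_le {u v : ℕ} (hu : 1 ≤ u) (hv : 1 ≤ v) {c : ℝ} (hc : 0 < c)
    (hgap : (2 * (u : ℝ) + v) / v * density * c ^ 2 / 4 < phitilde ((u : ℝ) / v)) :
    ∃ κ : ℝ, 0 < κ ∧ ∀ᶠ s : ℕ in atTop, ∀ x₀ : ℝ, 0 ≤ x₀ → x₀ ≤ ((u : ℝ) / v) * ((u : ℝ) / v + 1) →
      Lam u v s (Bfun c s) x₀ ≤ -(1 + κ) * ((s : ℝ) + 1) := by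
  have hv0 : (0 : ℝ) < v := by exact_mod_cast hv
  have hv1 : (1 : ℝ) ≤ v := by exact_mod_cast hv
  have hu0 : (0 : ℝ) < u := by exact_mod_cast hu
  set ρ : ℝ := (2 * (u : ℝ) + v) / v with hρdef
  set R : ℝ := ((u : ℝ) / v) * ((u : ℝ) / v + 1) with hRdef
  have hρ0 : 0 < ρ := by positivity
  have hR0 : 0 ≤ R := by positivity
  -- the gap `2κ₀ = φ̃(r) − ρ A c²/4 > 0`
  obtain ⟨κ₀, hκ₀, hκ₀'⟩ : ∃ κ₀ : ℝ, 0 < κ₀ ∧ ρ * density * c ^ 2 / 4 + 2 * κ₀ = phitilde ((u : ℝ) / v) :=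
    ⟨(phitilde ((u : ℝ) / v) - ρ * density * c ^ 2 / 4) / 2, by linarith, by ring⟩
  -- the coefficient of `N`
  set K : ℝ := ρ * (1 + Real.log v) + ρ * Real.log (R + ρ) with hKdef
  have hlogv : 0 ≤ Real.log v := Real.log_nonneg hv1
  have hlogR : 0 ≤ Real.log (R + ρ) := by
    apply Real.log_nonneg
    have : 1 ≤ ρ := by
      rw [hρdef, le_div_iff₀ hv0]
      linarith
    linarith
  have hK0 : 0 < K := by
    have : 0 < ρ * (1 + Real.log v) := mul_pos hρ0 (by linarith)
    have : 0 ≤ ρ * Real.log (R + ρ) := mul_nonneg hρ0.le hlogR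
    linarith
  refine ⟨κ₀, hκ₀, ?_⟩
  have hA₁ : ∀ᶠ s : ℕ in atTop, Real.log (A₁ ((u : ℚ) / v) (Bfun c s)) / ((s : ℝ) + 1) <
      ρ * density * c ^ 2 / 4 + κ₀ / 2 :=
    (tendsto_log_A₁_Bfun_div hu hv hc).eventually_lt_const (by linarith)
  have hA₂ := eventually_log_A₂_Bfun_le hu hv hc (show 0 < κ₀ / 4 by linarith)
  have hN := eventually_card_zeroSet_Bfun_le hc (show 0 < κ₀ / (4 * K) by positivity)
  filter_upwards [hA₁, hA₂, hN] with s h1 h2 h3 x₀ hx₀ hxR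
  have hs1 : (0 : ℝ) < (s : ℝ) + 1 := by positivity
  have h0 := Lam_le_of_le hu hv s (Bfun c s) hx₀ hxR
  rw [div_lt_iff₀ hs1] at h1
  set N : ℝ := ((zeroSet_finite (Bfun c s)).toFinset.card : ℝ)
  have hNK : ρ * N * (1 + Real.log v) + N * (ρ * Real.log (R + ρ)) = K * N := by rw [hKdef]; ring
  have h3' : K * N ≤ K * (κ₀ / (4 * K) * ((s : ℝ) + 1)) := mul_le_mul_of_nonneg_left h3 hK0.le
  have e : K * (κ₀ / (4 * K) * ((s : ℝ) + 1)) = κ₀ / 4 * ((s : ℝ) + 1) := by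
    field_simp
  rw [e] at h3'
  have h4 : ((s : ℝ) + 1) * phitilde ((u : ℝ) / v) = ((s : ℝ) + 1) * (ρ * density * c ^ 2 / 4 + 2 * κ₀) := by
    rw [hκ₀']
  nlinarith
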